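import Mathlib.Analysis.SpecialFunctions.Pow.Real
import Mathlib.Analysis.SpecialFunctions.Log.Basic
import Mathlib.Analysis.SpecialFunctions.Sqrt
import Literature.MathematicalPhysics.QuantumFieldTheory.Balaban1983to89.B4Eq19LatticeOperators
import HarnessLib

/-!
# Crux stmt-QuantumFields-19936 `UnitScaleTilt.HistoryTailL`, route crux `PoincareLipschitz.BlockLipschitzL` (stmt-QuantumFields-23533), K2 FINAL KNIT
# `hRegH ⟸ hImprove ∧ [C]` — K-2 §1 «DOOR ROWS»: the PURE-REAL discharge of the two source rows of the E→R door with an additive source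
# ✓`PoincareLipschitzSmallRangeOfOneStepSrc.norm_sub_le_of_oneStep_src` — (i) THRESHOLD PROPAGATION `(2m^{d−1})⁻¹·T(m^{k+1}) + s(m^{k+1}) ≤ T(m^k)` and
# (ii) MORREY CLASS `s(m^k) ≤ N_s·(m^{d−1})^k` — at `d = 3`, for the road's threshold `T r = ε₁·r·g r` (`g` antitone, the road: `g r = (1 + log r)^{−6}`,
# ✓`PoincareLipschitzSmallRangeOfOneStep.threshold_of_antitone`'s shape) and the TWIST-SLACK source `s r ≤ 2·sl(r)`, `sl(r) = 4τ₀√(81r³·T r) + 2τ₀²·81r³`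
# (= ✓`PoincareLipschitzOrbitMinTwistSlack.flat_almostMin_of_twisted_localMin`'s slack `2τ₀(√(N·E(u)) + √(N·E(v))) + 2τ₀²N`, `N = 3·#Q_r = 3(2r+1)³ ≤ 81r³`,
# read below the threshold `E(u) ≤ T r`, doubled by ✓`PoincareLipschitzSphereMapOneStepFixedGeometry.oneStep_fixedGeometry_of_slack`'s `+ 2·sl`), under ONE regime
# row `288·τ₀·m^{K+1} ≤ √(ε₁·g(m^K))` (road: `288·τ₀·m^{K+1}·(1 + log m^K)³ ≤ √ε₁`, packaged as `τ₀·m^K·(1 + log m^K)⁶ ≤ c := √ε₁∕(288m)`) and with the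
# Morrey constant `N_s = 72τ₀√ε₁ + 324τ₀²m^K ≤ 324·(τ₀√ε₁ + τ₀²m^K)`

Cell `ym3-torus` (YM ladder rung R3 = continuum SU(2) Yang–Mills on the three-torus — a RUNG, NOT the Clay problem: not d = 4, not infinite volume, not a mass
gap); width seat `ym-ust-19936-w2` gen 12 (LEAD ym-ust-19936-w1 g9 2026-08-29T06:41:10Z WORD «O1 DOOR ROWS GO … this IS K-2 §1, I import it»).  THEOREMS
ONLY (def-free, default heartbeats), Mathlib + lit ✓`B4Eq19LatticeOperators` (`Zd`, `box`, `card_box`) + HarnessLib; `--supports stmt-QuantumFields-19936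
--as helper`.  Nothing here proves the door, F5, `hImprove`, `hRegH`, a stub, `BlockLipschitzL`, `HistoryTailL` or a summit statement — real arithmetic only.

WHAT IS PROVED (ns `Summit.QuantumFields.YangMills.Theorems.PoincareLipschitzKnitDoorRows`).
* §1 SLACK LETTERS: ★ `slack_const_of_threshold` (the twist slack `2τ₀(√(N·E(u)) + √(N·E(v))) + 2τ₀²N` is `≤ 4τ₀√(N·T) + 2τ₀²N` whenever `E(u) ≤ T` — case
  `E(v) ≥ E(u)` trivial, else `√(N·E(v)) ≤ √(N·E(u)) ≤ √(N·T)`); `slack_mono` (monotone in `N`); `card_box_mul_le` (`d·#Q_r(z) ≤ d·3^d·r^d`, `r ≥ 1`) and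
  `three_mul_card_box_le` (`3·#Q_r(z) ≤ 81·r³` on `ℤ³`).
* §2 THRESHOLD LETTERS for the road's weight `g r = ((1 + log r)^6)⁻¹`: `roadWeight_nonneg`, `roadWeight_antitone`, `roadWeight_one`, `sqrt_mul_roadWeight`
  (`√(ε·g r) = √ε ∕ (1 + log r)³`).
* §3 THE ROWS (d = 3, letters of ✓`norm_sub_le_of_oneStep_src` with `d := 3`: `(2·m²)⁻¹`, `(m²)^k` — the door's `m^{d−1}` at `d = 3` by `rfl`): ★★ `rowOne_core`
  (eight-letter real core), ★★★ `doorRow_threshold` (row (i) for every `k < K` from the regime row `288·τ₀·m^{K+1} ≤ √(ε₀·g(m^K))`), ★★★ `doorRow_morrey`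
  (row (ii) for `1 ≤ k ≤ K` with `N_s = 72τ₀√ε₀ + 324τ₀²m^K`, needs only `g 1 ≤ 1`).
* §4 THE ROAD'S INSTANCES in LEAD's letters (`T r = ε₁·r∕(1 + log r)^6`, `s r ≤ 2·(4τ₀√(3(2r+1)³·T r) + 2τ₀²·3(2r+1)³)`): `roadThreshold_nonneg`,
  ★ `source_three_le_source_81`, ★★★ `doorRow_threshold_log6` (regime `288·τ₀·m^{K+1}·(1 + log m^K)³ ≤ √ε₁`), ★★★ `doorRow_morrey_log6`
  (`N_s = 324·(τ₀√ε₁ + τ₀²m^K)`), ★★★ `doorRows_log6` (PACKAGED: `∀ m ≥ 2, ∀ ε₁ > 0, ∃ c > 0, ∀ τ₀ K T s, … → τ₀·m^K·(1 + log m^K)⁶ ≤ c → (i) ∧ (ii)`,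
  `c = √ε₁∕(288m)`).
ARITHMETIC OF RECORD (row (i), `k < K`, `r₁ = m^{k+1}`, `g_k ≥ g_{k+1} ≥ g_K`): `(2m²)⁻¹T(r₁) ≤ T(m^k)∕(2m) ≤ ¼T(m^k)`; `s(r₁) ≤ 72τ₀r₁²√(ε₀g_{k+1}) + 324τ₀²r₁³`;
`288τ₀·m·r₁ ≤ 288τ₀m^{K+1} ≤ √(ε₀g_K) ≤ √(ε₀g_{k+1})` gives `72τ₀r₁²√(ε₀g_{k+1}) ≤ ¼ε₀m^kg_{k+1} ≤ ¼T(m^k)` and, squared, `324τ₀²r₁³ ≤ (648∕(288²m))·ε₀m^kg_{k+1} ≤ ½T(m^k)`.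
HONEST SCOPE.  Pure real inequalities; YM₃ on T³ is rung R3, not Clay; YM gap NOT proved.

References: M. Giaquinta, Annals of Math. Studies 105 (1983) [Giaquinta1984] (Ch. III Lemma 2.1 p.86: the iteration lemma with an additive `B·R^β` slot);
R. Schoen, K. Uhlenbeck, J. Diff. Geom. 17 (1982) 307–335 [SchoenUhlenbeck1982] (§4: the energy-improvement iteration).
-/

set_option autoImplicit false

noncomputable section

open scoped BigOperators

namespace Summit.QuantumFields.YangMills.Theorems.PoincareLipschitzKnitDoorRows

open Literature.MathematicalPhysics.QuantumFieldTheory.Balaban1983to89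
open B4Eq19LatticeOperators (Zd box card_box)

/-! ## §1 Slack letters: the twist slack below the threshold is a function of the radius only -/

/-- ★ **THE TWIST SLACK BELOW THE THRESHOLD.**  If `E(u) ≤ T`, `0 ≤ τ₀, N` and
`E(u) ≤ E(v) + 2τ₀(√(N·E(u)) + √(N·E(v))) + 2(τ₀²N)` (✓`flat_almostMin_of_twisted_localMin`'s letters), then `E(u) ≤ E(v) + (4τ₀√(N·T) + 2τ₀²N)`:
for `E(v) ≥ E(u)` there is nothing to prove, otherwise `√(N·E(v)) ≤ √(N·E(u)) ≤ √(N·T)`. [folklore] [cite: Giaquinta1984, Ch. III §1 p.64] -/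
theorem slack_const_of_threshold {Eu Ev N T τ₀ : ℝ} (hτ0 : 0 ≤ τ₀) (hN : 0 ≤ N) (hEuT : Eu ≤ T)
    (h : Eu ≤ Ev + 2 * τ₀ * (Real.sqrt (N * Eu) + Real.sqrt (N * Ev)) + 2 * (τ₀ ^ 2 * N)) :
    Eu ≤ Ev + (4 * τ₀ * Real.sqrt (N * T) + 2 * τ₀ ^ 2 * N) := by
  have hslack : 0 ≤ 4 * τ₀ * Real.sqrt (N * T) + 2 * τ₀ ^ 2 * N := by positivity
  by_cases hc : Eu ≤ Ev
  · linarith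
  · push Not at hc
    have h1 : Real.sqrt (N * Ev) ≤ Real.sqrt (N * T) :=
      Real.sqrt_le_sqrt (mul_le_mul_of_nonneg_left (by linarith) hN)
    have h2 : Real.sqrt (N * Eu) ≤ Real.sqrt (N * T) :=
      Real.sqrt_le_sqrt (mul_le_mul_of_nonneg_left hEuT hN)
    have h3 : 2 * τ₀ * (Real.sqrt (N * Eu) + Real.sqrt (N * Ev)) ≤ 4 * τ₀ * Real.sqrt (N * T) := by
      have := mul_le_mul_of_nonneg_left (add_le_add h2 h1) (by positivity : (0 : ℝ) ≤ 2 * τ₀)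
      linarith
    linarith

/-- The constant slack `4τ₀√(N·T) + 2τ₀²N` is monotone in `N` (`τ₀, T ≥ 0`). [folklore] -/
theorem slack_mono {N N' T τ₀ : ℝ} (hτ0 : 0 ≤ τ₀) (hNN : N ≤ N') (hT : 0 ≤ T) :
    4 * τ₀ * Real.sqrt (N * T) + 2 * τ₀ ^ 2 * N ≤ 4 * τ₀ * Real.sqrt (N' * T) + 2 * τ₀ ^ 2 * N' := by
  have h1 : Real.sqrt (N * T) ≤ Real.sqrt (N' * T) := Real.sqrt_le_sqrt (mul_le_mul_of_nonneg_right hNN hT)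
  have h2 : 4 * τ₀ * Real.sqrt (N * T) ≤ 4 * τ₀ * Real.sqrt (N' * T) := mul_le_mul_of_nonneg_left h1 (by positivity)
  have h3 : 2 * τ₀ ^ 2 * N ≤ 2 * τ₀ ^ 2 * N' := mul_le_mul_of_nonneg_left hNN (by positivity)
  linarith

/-- `d·#Q_r(z) ≤ d·3^d·r^d` for `r ≥ 1` (since `#Q_r = (2r+1)^d ≤ (3r)^d`). [folklore] [cite: Giaquinta1984, Ch. III §1 p.64] -/
theorem card_box_mul_le {d : ℕ} (z : Zd d) {r : ℤ} (hr : 1 ≤ r) :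
    (d : ℝ) * ((box z r).card : ℝ) ≤ (d : ℝ) * 3 ^ d * (r : ℝ) ^ d := by
  have hr0 : (0 : ℤ) ≤ r := by linarith
  have hr1 : (1 : ℝ) ≤ r := by exact_mod_cast hr
  rw [card_box z hr0]
  push_cast
  have h1 : (2 * (r : ℝ) + 1) ^ d ≤ (3 * (r : ℝ)) ^ d :=
    pow_le_pow_left₀ (by linarith) (by linarith) d
  rw [mul_pow] at h1
  have hd : (0 : ℝ) ≤ d := Nat.cast_nonneg d
  have := mul_le_mul_of_nonneg_left h1 hd
  linarith [this]

/-- On `ℤ³`: `3·#Q_r(z) ≤ 81·r³` for `r ≥ 1` — so the knit may take the slack at `N := 81r³`. [folklore] [cite: Giaquinta1984, Ch. III §1 p.64] -/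
theorem three_mul_card_box_le (z : Zd 3) {r : ℤ} (hr : 1 ≤ r) :
    ((3 : ℕ) : ℝ) * ((box z r).card : ℝ) ≤ 81 * (r : ℝ) ^ 3 := by
  have := card_box_mul_le (d := 3) z hr
  norm_num at this ⊢
  linarith

/-! ## §2 Threshold letters: the road's weight `g r = ((1 + log r)^6)⁻¹` (`T r = ε·r·g r`, ✓`threshold_of_antitone`'s shape) -/

/-- The road's weight is nonnegative on `[1, ∞)`: `0 ≤ ((1 + log x)^6)⁻¹`. [folklore] -/
theorem roadWeight_nonneg (x : ℝ) (hx : 1 ≤ x) : 0 ≤ ((1 + Real.log x) ^ 6)⁻¹ := by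
  have := Real.log_nonneg hx
  positivity

/-- The road's weight is antitone on `[1, ∞)`. [folklore] -/
theorem roadWeight_antitone (x y : ℝ) (hx : 1 ≤ x) (hxy : x ≤ y) :
    ((1 + Real.log y) ^ 6)⁻¹ ≤ ((1 + Real.log x) ^ 6)⁻¹ := by
  have hlx : 0 ≤ Real.log x := Real.log_nonneg hx
  have hlxy : Real.log x ≤ Real.log y := Real.log_le_log (by linarith) hxy
  have h1 : (1 + Real.log x) ^ 6 ≤ (1 + Real.log y) ^ 6 := pow_le_pow_left₀ (by linarith) (by linarith) 6
  exact inv_anti₀ (by positivity) h1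

/-- The road's weight at `1` is `1`. [folklore] -/
theorem roadWeight_one : ((1 + Real.log (1 : ℝ)) ^ 6)⁻¹ = 1 := by
  simp

/-- `√(ε₀·((1 + log x)^6)⁻¹) = √ε₀ ∕ (1 + log x)³` for `x ≥ 1`. [folklore] -/
theorem sqrt_mul_roadWeight {ε₀ : ℝ} (x : ℝ) (hx : 1 ≤ x) :
    Real.sqrt (ε₀ * ((1 + Real.log x) ^ 6)⁻¹) = Real.sqrt ε₀ / (1 + Real.log x) ^ 3 := by
  have hl : 0 ≤ 1 + Real.log x := by have := Real.log_nonneg hx; linarith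
  have h6 : (1 + Real.log x) ^ 6 = ((1 + Real.log x) ^ 3) ^ 2 := by ring
  rw [h6, Real.sqrt_mul' _ (by positivity), Real.sqrt_inv, Real.sqrt_sq (by positivity), div_eq_mul_inv]

/-! ## §3 The two door rows at `d = 3` -/

/-- ★★ **ROW (i), PURE-REAL CORE** (eight letters: `m ≥ 2`, `ε₀, τ₀ ≥ 0`, `M = m^k ≥ 1`, weights `0 ≤ g₁ ≤ g₀` at `m·M` and `M`, `S = √(ε₀g₁)` given by
`S ≥ 0 ∧ S·S = ε₀g₁`, the regime row `288τ₀·m·(mM) ≤ S`, the source bound `s₁ ≤ 72τ₀(mM)²S + 324τ₀²(mM)³`):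
`(2m²)⁻¹·(ε₀·(mM)·g₁) + s₁ ≤ ε₀·M·g₀`. [folklore] [cite: Giaquinta1984, Ch. III Lemma 2.1 p.86] -/
theorem rowOne_core {m ε₀ τ₀ M g₀ g₁ S s₁ : ℝ} (hm : 2 ≤ m) (hε₀ : 0 ≤ ε₀) (hτ0 : 0 ≤ τ₀) (hM : 1 ≤ M) (hg₁ : 0 ≤ g₁) (hg : g₁ ≤ g₀)
    (hS0 : 0 ≤ S) (hSS : S * S = ε₀ * g₁) (hreg : 288 * τ₀ * (m * (m * M)) ≤ S)
    (hs : s₁ ≤ 72 * τ₀ * (m * M) ^ 2 * S + 324 * τ₀ ^ 2 * (m * M) ^ 3) :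
    (2 * m ^ 2)⁻¹ * (ε₀ * (m * M) * g₁) + s₁ ≤ ε₀ * M * g₀ := by
  have hm0 : 0 < m := by linarith
  have hM0 : 0 ≤ M := by linarith
  -- the two energies at scale `M`
  have hP0 : 0 ≤ ε₀ * M * g₁ := by positivity
  have hPP : ε₀ * M * g₁ ≤ ε₀ * M * g₀ := mul_le_mul_of_nonneg_left hg (by positivity)
  -- (a) the ladder term `= (ε₀ M g₁)∕(2m) ≤ ¼ ε₀ M g₁`
  have hA : (2 * m ^ 2)⁻¹ * (ε₀ * (m * M) * g₁) ≤ 1 / 4 * (ε₀ * M * g₁) := by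
    have e : (2 * m ^ 2)⁻¹ * (ε₀ * (m * M) * g₁) = (ε₀ * M * g₁) * (2 * m)⁻¹ := by
      field_simp
    rw [e]
    have h4 : (2 * m)⁻¹ ≤ (1 / 4 : ℝ) := by
      rw [inv_le_comm₀ (by positivity) (by norm_num)]
      norm_num; linarith
    have := mul_le_mul_of_nonneg_left h4 hP0
    linarith
  -- (b) term A: multiply the regime row by `(mM)·S ≥ 0`
  have hB : 72 * τ₀ * (m * M) ^ 2 * S ≤ 1 / 4 * (ε₀ * M * g₁) := by
    have h1 := mul_le_mul_of_nonneg_right hreg (by positivity : (0 : ℝ) ≤ (m * M) * S)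
    have e1 : 288 * τ₀ * (m * (m * M)) * ((m * M) * S) = (4 * m) * (72 * τ₀ * (m * M) ^ 2 * S) := by ring
    have e2 : S * ((m * M) * S) = (4 * m) * (1 / 4 * (ε₀ * M * g₁)) := by
      have : S * ((m * M) * S) = (m * M) * (S * S) := by ring
      rw [this, hSS]; ring
    rw [e1, e2] at h1
    exact le_of_mul_le_mul_left h1 (by positivity)
  -- (c) term B: square the regime row
  have hC : 324 * τ₀ ^ 2 * (m * M) ^ 3 ≤ 1 / 2 * (ε₀ * M * g₁) := by
    have h1 : (288 * τ₀ * (m * (m * M))) ^ 2 ≤ S ^ 2 := pow_le_pow_left₀ (by positivity) hreg 2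
    have h2 : S ^ 2 = ε₀ * g₁ := by rw [sq, hSS]
    rw [h2] at h1
    -- `648 τ₀² (mM)² m ≤ (288 τ₀ m (mM))²` since `648 ≤ 82944 m`
    have h3 : 648 * τ₀ ^ 2 * (m * M) ^ 2 * m ≤ (288 * τ₀ * (m * (m * M))) ^ 2 := by
      have hq : (0 : ℝ) ≤ τ₀ ^ 2 * (m * M) ^ 2 * m := by positivity
      have e : (288 * τ₀ * (m * (m * M))) ^ 2 - 648 * τ₀ ^ 2 * (m * M) ^ 2 * m = (82944 * m - 648) * (τ₀ ^ 2 * (m * M) ^ 2 * m) := by ring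
      have h82 : (0 : ℝ) ≤ 82944 * m - 648 := by linarith
      nlinarith [mul_nonneg h82 hq, e]
    have h4 : 648 * τ₀ ^ 2 * (m * M) ^ 2 * m ≤ ε₀ * g₁ := h3.trans h1
    have h5 := mul_le_mul_of_nonneg_right h4 hM0
    have e5 : 648 * τ₀ ^ 2 * (m * M) ^ 2 * m * M = 2 * (324 * τ₀ ^ 2 * (m * M) ^ 3) := by ring
    have e6 : ε₀ * g₁ * M = 2 * (1 / 2 * (ε₀ * M * g₁)) := by ring
    rw [e5, e6] at h5
    linarith
  -- (d) assemble
  linarith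

/-- ★★★ **ROW (i) — THRESHOLD PROPAGATION WITH THE TWIST-SLACK SOURCE** (letters of ✓`norm_sub_le_of_oneStep_src` at `d := 3`).  DATA: `m ≥ 2`, `ε₀, τ₀ ≥ 0`,
`g ≥ 0` antitone on `[1, ∞)`, `T r = ε₀·r·g r` (`r ≥ 1`), a source with `s r ≤ 2·(4τ₀√(81r³·T r) + 2τ₀²·81r³)` (`r ≥ 1`), and the REGIME ROW
`288·τ₀·m^{K+1} ≤ √(ε₀·g(m^K))`.  THEN for every `k < K`: `(2·m²)⁻¹·T(m^{k+1}) + s(m^{k+1}) ≤ T(m^k)` (the door's `(2·m^{d−1})⁻¹` at `d = 3`, by `rfl`).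
[folklore] [cite: Giaquinta1984, Ch. III Lemma 2.1 p.86] -/
theorem doorRow_threshold {m : ℕ} (hm : 2 ≤ m) {ε₀ τ₀ : ℝ} (hε₀ : 0 ≤ ε₀) (hτ0 : 0 ≤ τ₀) (g : ℝ → ℝ) (hg0 : ∀ x : ℝ, 1 ≤ x → 0 ≤ g x)
    (hg : ∀ x y : ℝ, 1 ≤ x → x ≤ y → g y ≤ g x) (T : ℤ → ℝ) (hT : ∀ r : ℤ, 1 ≤ r → T r = ε₀ * r * g r) (s : ℤ → ℝ)
    (hs : ∀ r : ℤ, 1 ≤ r → s r ≤ 2 * (4 * τ₀ * Real.sqrt (81 * (r : ℝ) ^ 3 * T r) + 2 * τ₀ ^ 2 * (81 * (r : ℝ) ^ 3)))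
    (K : ℕ) (hreg : 288 * τ₀ * (m : ℝ) ^ (K + 1) ≤ Real.sqrt (ε₀ * g ((m : ℝ) ^ K))) :
    ∀ k : ℕ, k < K → (2 * (m : ℝ) ^ 2)⁻¹ * T ((m : ℤ) ^ (k + 1)) + s ((m : ℤ) ^ (k + 1)) ≤ T ((m : ℤ) ^ k) := by
  intro k hk
  have hm1 : (1 : ℝ) ≤ m := by exact_mod_cast (by omega : 1 ≤ m)
  have hm2 : (2 : ℝ) ≤ m := by exact_mod_cast hm
  have hm0 : (0 : ℝ) < m := by linarith
  have hmz : (1 : ℤ) ≤ m := by exact_mod_cast (by omega : 1 ≤ m)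
  have hkz : (1 : ℤ) ≤ (m : ℤ) ^ k := one_le_pow₀ hmz
  have hk1z : (1 : ℤ) ≤ (m : ℤ) ^ (k + 1) := one_le_pow₀ hmz
  -- real letters: `M = m^k`, `r₁ = m^{k+1} = m·M`
  have hc0 : (((m : ℤ) ^ k : ℤ) : ℝ) = (m : ℝ) ^ k := by push_cast; ring
  have hc1 : (((m : ℤ) ^ (k + 1) : ℤ) : ℝ) = (m : ℝ) * (m : ℝ) ^ k := by push_cast; ring
  have hM1 : (1 : ℝ) ≤ (m : ℝ) ^ k := one_le_pow₀ hm1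
  have hMr : (m : ℝ) ^ k ≤ (m : ℝ) * (m : ℝ) ^ k := by
    have := mul_le_mul_of_nonneg_right hm1 (by positivity : (0 : ℝ) ≤ (m : ℝ) ^ k)
    linarith
  have hr1 : (1 : ℝ) ≤ (m : ℝ) * (m : ℝ) ^ k := hM1.trans hMr
  have hrK : (m : ℝ) * (m : ℝ) ^ k ≤ (m : ℝ) ^ K := by
    rw [← pow_succ']; exact pow_le_pow_right₀ hm1 (by omega)
  have hrK' : (m : ℝ) * ((m : ℝ) * (m : ℝ) ^ k) ≤ (m : ℝ) ^ (K + 1) := by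
    rw [pow_succ']; exact mul_le_mul_of_nonneg_left hrK hm0.le
  -- weights
  have hg₁ : 0 ≤ g ((m : ℝ) * (m : ℝ) ^ k) := hg0 _ hr1
  have hgg : g ((m : ℝ) * (m : ℝ) ^ k) ≤ g ((m : ℝ) ^ k) := hg _ _ hM1 hMr
  have hgK : g ((m : ℝ) ^ K) ≤ g ((m : ℝ) * (m : ℝ) ^ k) := hg _ _ hr1 hrK
  -- thresholds
  have hT0 : T ((m : ℤ) ^ k) = ε₀ * (m : ℝ) ^ k * g ((m : ℝ) ^ k) := by rw [hT _ hkz, hc0]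
  have hT1 : T ((m : ℤ) ^ (k + 1)) = ε₀ * ((m : ℝ) * (m : ℝ) ^ k) * g ((m : ℝ) * (m : ℝ) ^ k) := by rw [hT _ hk1z, hc1]
  -- `S = √(ε₀ g r₁)` and the source bound
  have hS0 : 0 ≤ Real.sqrt (ε₀ * g ((m : ℝ) * (m : ℝ) ^ k)) := Real.sqrt_nonneg _
  have hSS : Real.sqrt (ε₀ * g ((m : ℝ) * (m : ℝ) ^ k)) * Real.sqrt (ε₀ * g ((m : ℝ) * (m : ℝ) ^ k)) =
      ε₀ * g ((m : ℝ) * (m : ℝ) ^ k) := Real.mul_self_sqrt (mul_nonneg hε₀ hg₁)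
  have hsqrt : Real.sqrt (81 * ((m : ℝ) * (m : ℝ) ^ k) ^ 3 * T ((m : ℤ) ^ (k + 1))) =
      9 * ((m : ℝ) * (m : ℝ) ^ k) ^ 2 * Real.sqrt (ε₀ * g ((m : ℝ) * (m : ℝ) ^ k)) := by
    rw [hT1, show 81 * ((m : ℝ) * (m : ℝ) ^ k) ^ 3 * (ε₀ * ((m : ℝ) * (m : ℝ) ^ k) * g ((m : ℝ) * (m : ℝ) ^ k)) =
      (9 * ((m : ℝ) * (m : ℝ) ^ k) ^ 2) ^ 2 * (ε₀ * g ((m : ℝ) * (m : ℝ) ^ k)) by ring,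
      Real.sqrt_mul' _ (mul_nonneg hε₀ hg₁), Real.sqrt_sq (by positivity)]
  have hsB : s ((m : ℤ) ^ (k + 1)) ≤ 72 * τ₀ * ((m : ℝ) * (m : ℝ) ^ k) ^ 2 * Real.sqrt (ε₀ * g ((m : ℝ) * (m : ℝ) ^ k)) +
      324 * τ₀ ^ 2 * ((m : ℝ) * (m : ℝ) ^ k) ^ 3 := by
    have := hs _ hk1z
    rw [hc1, hsqrt] at this
    linarith
  -- the regime row at this level
  have hregk : 288 * τ₀ * ((m : ℝ) * ((m : ℝ) * (m : ℝ) ^ k)) ≤ Real.sqrt (ε₀ * g ((m : ℝ) * (m : ℝ) ^ k)) := by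
    have h1 : 288 * τ₀ * ((m : ℝ) * ((m : ℝ) * (m : ℝ) ^ k)) ≤ 288 * τ₀ * (m : ℝ) ^ (K + 1) :=
      mul_le_mul_of_nonneg_left hrK' (by positivity)
    have h2 : Real.sqrt (ε₀ * g ((m : ℝ) ^ K)) ≤ Real.sqrt (ε₀ * g ((m : ℝ) * (m : ℝ) ^ k)) :=
      Real.sqrt_le_sqrt (mul_le_mul_of_nonneg_left hgK hε₀)
    linarith
  -- assemble through the core
  rw [hT0, hT1]
  exact rowOne_core hm2 hε₀ hτ0 hM1 hg₁ hgg hS0 hSS hregk hsB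

/-- ★★★ **ROW (ii) — THE TWIST-SLACK SOURCE IS OF MORREY CLASS** (letters of ✓`norm_sub_le_of_oneStep_src` at `d := 3`).  DATA as in `doorRow_threshold` but
with `g 1 ≤ 1` instead of the regime row.  THEN for `1 ≤ k ≤ K`: `s(m^k) ≤ (72τ₀√ε₀ + 324τ₀²m^K)·(m²)^k` (the door's `(m^{d−1})^k` at `d = 3`).
[folklore] [cite: Giaquinta1984, Ch. III Lemma 2.1 p.86] -/
theorem doorRow_morrey {m : ℕ} (hm : 1 ≤ m) {ε₀ τ₀ : ℝ} (hε₀ : 0 ≤ ε₀) (hτ0 : 0 ≤ τ₀) (g : ℝ → ℝ) (hg0 : ∀ x : ℝ, 1 ≤ x → 0 ≤ g x)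
    (hg : ∀ x y : ℝ, 1 ≤ x → x ≤ y → g y ≤ g x) (hg1 : g 1 ≤ 1) (T : ℤ → ℝ) (hT : ∀ r : ℤ, 1 ≤ r → T r = ε₀ * r * g r) (s : ℤ → ℝ)
    (hs : ∀ r : ℤ, 1 ≤ r → s r ≤ 2 * (4 * τ₀ * Real.sqrt (81 * (r : ℝ) ^ 3 * T r) + 2 * τ₀ ^ 2 * (81 * (r : ℝ) ^ 3)))
    (K : ℕ) :
    ∀ k : ℕ, 1 ≤ k → k ≤ K → s ((m : ℤ) ^ k) ≤ (72 * τ₀ * Real.sqrt ε₀ + 324 * τ₀ ^ 2 * (m : ℝ) ^ K) * ((m : ℝ) ^ 2) ^ k := by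
  intro k _ hkK
  have hm1 : (1 : ℝ) ≤ m := by exact_mod_cast hm
  have hmz : (1 : ℤ) ≤ m := by exact_mod_cast hm
  have hkz : (1 : ℤ) ≤ (m : ℤ) ^ k := one_le_pow₀ hmz
  have hc : (((m : ℤ) ^ k : ℤ) : ℝ) = (m : ℝ) ^ k := by push_cast; ring
  have hr1 : (1 : ℝ) ≤ (m : ℝ) ^ k := one_le_pow₀ hm1
  have hrK : (m : ℝ) ^ k ≤ (m : ℝ) ^ K := pow_le_pow_right₀ hm1 hkK
  have hgr0 : 0 ≤ g ((m : ℝ) ^ k) := hg0 _ hr1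
  have hgr1 : g ((m : ℝ) ^ k) ≤ 1 := (hg 1 _ le_rfl hr1).trans hg1
  have hTr : T ((m : ℤ) ^ k) = ε₀ * (m : ℝ) ^ k * g ((m : ℝ) ^ k) := by rw [hT _ hkz, hc]
  have hS0 : 0 ≤ Real.sqrt (ε₀ * g ((m : ℝ) ^ k)) := Real.sqrt_nonneg _
  have hS1 : Real.sqrt (ε₀ * g ((m : ℝ) ^ k)) ≤ Real.sqrt ε₀ := by
    apply Real.sqrt_le_sqrt
    have := mul_le_mul_of_nonneg_left hgr1 hε₀
    linarith
  have hsqrt : Real.sqrt (81 * ((m : ℝ) ^ k) ^ 3 * T ((m : ℤ) ^ k)) = 9 * ((m : ℝ) ^ k) ^ 2 * Real.sqrt (ε₀ * g ((m : ℝ) ^ k)) := by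
    rw [hTr, show 81 * ((m : ℝ) ^ k) ^ 3 * (ε₀ * (m : ℝ) ^ k * g ((m : ℝ) ^ k)) = (9 * ((m : ℝ) ^ k) ^ 2) ^ 2 * (ε₀ * g ((m : ℝ) ^ k)) by ring,
      Real.sqrt_mul' _ (mul_nonneg hε₀ hgr0), Real.sqrt_sq (by positivity)]
  have hsB : s ((m : ℤ) ^ k) ≤ 72 * τ₀ * ((m : ℝ) ^ k) ^ 2 * Real.sqrt (ε₀ * g ((m : ℝ) ^ k)) + 324 * τ₀ ^ 2 * ((m : ℝ) ^ k) ^ 3 := by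
    have := hs _ hkz
    rw [hc, hsqrt] at this
    linarith
  have hpow : ((m : ℝ) ^ 2) ^ k = ((m : ℝ) ^ k) ^ 2 := by rw [← pow_mul, ← pow_mul, mul_comm]
  rw [hpow]
  have h1 : 72 * τ₀ * ((m : ℝ) ^ k) ^ 2 * Real.sqrt (ε₀ * g ((m : ℝ) ^ k)) ≤ 72 * τ₀ * Real.sqrt ε₀ * ((m : ℝ) ^ k) ^ 2 := by
    have := mul_le_mul_of_nonneg_left hS1 (by positivity : (0 : ℝ) ≤ 72 * τ₀ * ((m : ℝ) ^ k) ^ 2)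
    linarith
  have h2 : 324 * τ₀ ^ 2 * ((m : ℝ) ^ k) ^ 3 ≤ 324 * τ₀ ^ 2 * (m : ℝ) ^ K * ((m : ℝ) ^ k) ^ 2 := by
    have := mul_le_mul_of_nonneg_left hrK (by positivity : (0 : ℝ) ≤ 324 * τ₀ ^ 2 * ((m : ℝ) ^ k) ^ 2)
    have e1 : 324 * τ₀ ^ 2 * ((m : ℝ) ^ k) ^ 2 * (m : ℝ) ^ k = 324 * τ₀ ^ 2 * ((m : ℝ) ^ k) ^ 3 := by ring
    have e2 : 324 * τ₀ ^ 2 * ((m : ℝ) ^ k) ^ 2 * (m : ℝ) ^ K = 324 * τ₀ ^ 2 * (m : ℝ) ^ K * ((m : ℝ) ^ k) ^ 2 := by ring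
    linarith
  calc s ((m : ℤ) ^ k) ≤ 72 * τ₀ * ((m : ℝ) ^ k) ^ 2 * Real.sqrt (ε₀ * g ((m : ℝ) ^ k)) + 324 * τ₀ ^ 2 * ((m : ℝ) ^ k) ^ 3 := hsB
    _ ≤ 72 * τ₀ * Real.sqrt ε₀ * ((m : ℝ) ^ k) ^ 2 + 324 * τ₀ ^ 2 * (m : ℝ) ^ K * ((m : ℝ) ^ k) ^ 2 := add_le_add h1 h2
    _ = (72 * τ₀ * Real.sqrt ε₀ + 324 * τ₀ ^ 2 * (m : ℝ) ^ K) * ((m : ℝ) ^ k) ^ 2 := by ring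

/-! ## §4 The road's instances: `T r = ε₁·r∕(1 + log r)^6`, source letter `N_r = 3(2r+1)³` (LEAD w1 g9 06:49:23Z «ASKS BY NAME») -/

/-- The road's threshold is nonnegative at `r ≥ 1`. [folklore] -/
theorem roadThreshold_nonneg {ε₁ : ℝ} (hε₁ : 0 ≤ ε₁) (T : ℤ → ℝ) (hT : ∀ r : ℤ, 1 ≤ r → T r = ε₁ * r / (1 + Real.log r) ^ 6)
    {r : ℤ} (hr : 1 ≤ r) : 0 ≤ T r := by
  have hr1 : (1 : ℝ) ≤ r := by exact_mod_cast hr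
  have hl : 0 ≤ Real.log (r : ℝ) := Real.log_nonneg hr1
  rw [hT r hr]
  positivity

/-- ★ **THE SOURCE LETTER `3(2r+1)³ ≤ 81r³`**: for `r ≥ 1` and `T r ≥ 0`,
`2·(4τ₀√(3(2r+1)³·T r) + 2τ₀²·3(2r+1)³) ≤ 2·(4τ₀√(81r³·T r) + 2τ₀²·81r³)`. [folklore] [cite: Giaquinta1984, Ch. III §1 p.64] -/
theorem source_three_le_source_81 {τ₀ Tr : ℝ} (hτ0 : 0 ≤ τ₀) (hTr : 0 ≤ Tr) {r : ℤ} (hr : 1 ≤ r) :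
    2 * (4 * τ₀ * Real.sqrt (3 * (2 * (r : ℝ) + 1) ^ 3 * Tr) + 2 * τ₀ ^ 2 * (3 * (2 * (r : ℝ) + 1) ^ 3)) ≤
      2 * (4 * τ₀ * Real.sqrt (81 * (r : ℝ) ^ 3 * Tr) + 2 * τ₀ ^ 2 * (81 * (r : ℝ) ^ 3)) := by
  have hr1 : (1 : ℝ) ≤ r := by exact_mod_cast hr
  have h1 : (2 * (r : ℝ) + 1) ^ 3 ≤ (3 * (r : ℝ)) ^ 3 := pow_le_pow_left₀ (by linarith) (by linarith) 3
  have hN : 3 * (2 * (r : ℝ) + 1) ^ 3 ≤ 81 * (r : ℝ) ^ 3 := by rw [mul_pow] at h1; linarith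
  have := slack_mono (T := Tr) hτ0 hN hTr
  linarith

/-- ★★★ **ROW (i) ON THE ROAD** (explicit regime): `T r = ε₁·r∕(1 + log r)^6`, `s r ≤ 2·(4τ₀√(3(2r+1)³·T r) + 2τ₀²·3(2r+1)³)` (`r ≥ 1`), and
`288·τ₀·m^{K+1}·(1 + log m^K)³ ≤ √ε₁` ⟹ for every `k < K`, `(2·m²)⁻¹·T(m^{k+1}) + s(m^{k+1}) ≤ T(m^k)`. [folklore] [cite: Giaquinta1984, Ch. III Lemma 2.1 p.86] -/
theorem doorRow_threshold_log6 {m : ℕ} (hm : 2 ≤ m) {ε₁ τ₀ : ℝ} (hε₁ : 0 ≤ ε₁) (hτ0 : 0 ≤ τ₀) (T : ℤ → ℝ)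
    (hT : ∀ r : ℤ, 1 ≤ r → T r = ε₁ * r / (1 + Real.log r) ^ 6) (s : ℤ → ℝ)
    (hs : ∀ r : ℤ, 1 ≤ r → s r ≤ 2 * (4 * τ₀ * Real.sqrt (3 * (2 * (r : ℝ) + 1) ^ 3 * T r) + 2 * τ₀ ^ 2 * (3 * (2 * (r : ℝ) + 1) ^ 3)))
    (K : ℕ) (hreg : 288 * τ₀ * (m : ℝ) ^ (K + 1) * (1 + Real.log ((m : ℝ) ^ K)) ^ 3 ≤ Real.sqrt ε₁) :
    ∀ k : ℕ, k < K → (2 * (m : ℝ) ^ 2)⁻¹ * T ((m : ℤ) ^ (k + 1)) + s ((m : ℤ) ^ (k + 1)) ≤ T ((m : ℤ) ^ k) := by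
  have hm1 : (1 : ℝ) ≤ m := by exact_mod_cast (by omega : 1 ≤ m)
  have hT' : ∀ r : ℤ, 1 ≤ r → T r = ε₁ * r * ((1 + Real.log r) ^ 6)⁻¹ := fun r hr => by rw [hT r hr, div_eq_mul_inv]
  have hs' : ∀ r : ℤ, 1 ≤ r → s r ≤ 2 * (4 * τ₀ * Real.sqrt (81 * (r : ℝ) ^ 3 * T r) + 2 * τ₀ ^ 2 * (81 * (r : ℝ) ^ 3)) :=
    fun r hr => (hs r hr).trans (source_three_le_source_81 hτ0 (roadThreshold_nonneg hε₁ T hT hr) hr)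
  refine doorRow_threshold hm hε₁ hτ0 (fun x => ((1 + Real.log x) ^ 6)⁻¹) roadWeight_nonneg roadWeight_antitone T hT' s hs' K ?_
  have hK1 : (1 : ℝ) ≤ (m : ℝ) ^ K := one_le_pow₀ hm1
  have hl : 0 < (1 + Real.log ((m : ℝ) ^ K)) ^ 3 := by have := Real.log_nonneg hK1; positivity
  rw [sqrt_mul_roadWeight _ hK1, le_div_iff₀ hl]
  exact hreg

/-- ★★★ **ROW (ii) ON THE ROAD**: `T r = ε₁·r∕(1 + log r)^6`, `s r ≤ 2·(4τ₀√(3(2r+1)³·T r) + 2τ₀²·3(2r+1)³)` (`r ≥ 1`) ⟹ for `1 ≤ k ≤ K`,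
`s(m^k) ≤ 324·(τ₀√ε₁ + τ₀²m^K)·(m²)^k`. [folklore] [cite: Giaquinta1984, Ch. III Lemma 2.1 p.86] -/
theorem doorRow_morrey_log6 {m : ℕ} (hm : 1 ≤ m) {ε₁ τ₀ : ℝ} (hε₁ : 0 ≤ ε₁) (hτ0 : 0 ≤ τ₀) (T : ℤ → ℝ)
    (hT : ∀ r : ℤ, 1 ≤ r → T r = ε₁ * r / (1 + Real.log r) ^ 6) (s : ℤ → ℝ)
    (hs : ∀ r : ℤ, 1 ≤ r → s r ≤ 2 * (4 * τ₀ * Real.sqrt (3 * (2 * (r : ℝ) + 1) ^ 3 * T r) + 2 * τ₀ ^ 2 * (3 * (2 * (r : ℝ) + 1) ^ 3)))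
    (K : ℕ) :
    ∀ k : ℕ, 1 ≤ k → k ≤ K → s ((m : ℤ) ^ k) ≤ 324 * (τ₀ * Real.sqrt ε₁ + τ₀ ^ 2 * (m : ℝ) ^ K) * ((m : ℝ) ^ 2) ^ k := by
  have hT' : ∀ r : ℤ, 1 ≤ r → T r = ε₁ * r * ((1 + Real.log r) ^ 6)⁻¹ := fun r hr => by rw [hT r hr, div_eq_mul_inv]
  have hs' : ∀ r : ℤ, 1 ≤ r → s r ≤ 2 * (4 * τ₀ * Real.sqrt (81 * (r : ℝ) ^ 3 * T r) + 2 * τ₀ ^ 2 * (81 * (r : ℝ) ^ 3)) :=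
    fun r hr => (hs r hr).trans (source_three_le_source_81 hτ0 (roadThreshold_nonneg hε₁ T hT hr) hr)
  intro k hk hkK
  have h := doorRow_morrey hm hε₁ hτ0 (fun x => ((1 + Real.log x) ^ 6)⁻¹) roadWeight_nonneg roadWeight_antitone (le_of_eq roadWeight_one)
    T hT' s hs' K k hk hkK
  have hpos : (0 : ℝ) ≤ ((m : ℝ) ^ 2) ^ k := by positivity
  have hcoef : 72 * τ₀ * Real.sqrt ε₁ + 324 * τ₀ ^ 2 * (m : ℝ) ^ K ≤ 324 * (τ₀ * Real.sqrt ε₁ + τ₀ ^ 2 * (m : ℝ) ^ K) := by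
    have : 0 ≤ τ₀ * Real.sqrt ε₁ := mul_nonneg hτ0 (Real.sqrt_nonneg _)
    linarith
  exact h.trans (mul_le_mul_of_nonneg_right hcoef hpos)

/-- ★★★ **THE DOOR ROWS, PACKAGED** (the quantifier shape LEAD asked for): for `m ≥ 2` and `ε₁ > 0` there is `c > 0` (namely `√ε₁∕(288m)`) such that for
all `τ₀ ≥ 0`, `K`, `T r = ε₁·r∕(1 + log r)^6` and `s r ≤ 2·(4τ₀√(3(2r+1)³·T r) + 2τ₀²·3(2r+1)³)` (`r ≥ 1`): the REGIME ROW `τ₀·m^K·(1 + log m^K)⁶ ≤ c` gives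
(i) `(2m²)⁻¹·T(m^{k+1}) + s(m^{k+1}) ≤ T(m^k)` for `k < K` and (ii) `s(m^k) ≤ 324·(τ₀√ε₁ + τ₀²m^K)·(m²)^k` for `1 ≤ k ≤ K` — i.e. ✓`norm_sub_le_of_oneStep_src`'s
`hT`∕`hS` at `d = 3` with `Ns := 324·(τ₀√ε₁ + τ₀²m^K)`. [folklore] [cite: Giaquinta1984, Ch. III Lemma 2.1 p.86; SchoenUhlenbeck1982, §4] -/
theorem doorRows_log6 {m : ℕ} (hm : 2 ≤ m) {ε₁ : ℝ} (hε₁ : 0 < ε₁) :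
    ∃ c : ℝ, 0 < c ∧ ∀ (τ₀ : ℝ) (K : ℕ) (T s : ℤ → ℝ), 0 ≤ τ₀ →
      (∀ r : ℤ, 1 ≤ r → T r = ε₁ * r / (1 + Real.log r) ^ 6) →
      (∀ r : ℤ, 1 ≤ r → s r ≤ 2 * (4 * τ₀ * Real.sqrt (3 * (2 * (r : ℝ) + 1) ^ 3 * T r) + 2 * τ₀ ^ 2 * (3 * (2 * (r : ℝ) + 1) ^ 3))) →
      τ₀ * (m : ℝ) ^ K * (1 + Real.log ((m : ℝ) ^ K)) ^ 6 ≤ c →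
      (∀ k : ℕ, k < K → (2 * (m : ℝ) ^ 2)⁻¹ * T ((m : ℤ) ^ (k + 1)) + s ((m : ℤ) ^ (k + 1)) ≤ T ((m : ℤ) ^ k)) ∧
      (∀ k : ℕ, 1 ≤ k → k ≤ K → s ((m : ℤ) ^ k) ≤ 324 * (τ₀ * Real.sqrt ε₁ + τ₀ ^ 2 * (m : ℝ) ^ K) * ((m : ℝ) ^ 2) ^ k) := by
  have hm1 : (1 : ℝ) ≤ m := by exact_mod_cast (by omega : 1 ≤ m)
  have hm0 : (0 : ℝ) < m := by linarith
  have hsq : 0 < Real.sqrt ε₁ := Real.sqrt_pos.2 hε₁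
  refine ⟨Real.sqrt ε₁ / (288 * m), by positivity, fun τ₀ K T s hτ0 hT hs hreg => ⟨?_, doorRow_morrey_log6 (by omega) hε₁.le hτ0 T hT s hs K⟩⟩
  refine doorRow_threshold_log6 hm hε₁.le hτ0 T hT s hs K ?_
  -- `288 τ₀ m^{K+1} ℓ³ ≤ 288 m · (τ₀ m^K ℓ⁶) ≤ 288 m · c = √ε₁`, using `1 ≤ ℓ := 1 + log m^K`
  have hK1 : (1 : ℝ) ≤ (m : ℝ) ^ K := one_le_pow₀ hm1
  have hl1 : 1 ≤ 1 + Real.log ((m : ℝ) ^ K) := by have := Real.log_nonneg hK1; linarith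
  have hl3 : (1 + Real.log ((m : ℝ) ^ K)) ^ 3 ≤ (1 + Real.log ((m : ℝ) ^ K)) ^ 6 := pow_le_pow_right₀ hl1 (by norm_num)
  have h1 : τ₀ * (m : ℝ) ^ K * (1 + Real.log ((m : ℝ) ^ K)) ^ 3 ≤ τ₀ * (m : ℝ) ^ K * (1 + Real.log ((m : ℝ) ^ K)) ^ 6 :=
    mul_le_mul_of_nonneg_left hl3 (by positivity)
  have h2 : τ₀ * (m : ℝ) ^ K * (1 + Real.log ((m : ℝ) ^ K)) ^ 3 ≤ Real.sqrt ε₁ / (288 * m) := h1.trans hreg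
  have h3 := mul_le_mul_of_nonneg_left h2 (by positivity : (0 : ℝ) ≤ 288 * m)
  have e1 : (288 * (m : ℝ)) * (τ₀ * (m : ℝ) ^ K * (1 + Real.log ((m : ℝ) ^ K)) ^ 3) = 288 * τ₀ * (m : ℝ) ^ (K + 1) * (1 + Real.log ((m : ℝ) ^ K)) ^ 3 := by
    rw [pow_succ]; ring
  have e2 : (288 * (m : ℝ)) * (Real.sqrt ε₁ / (288 * m)) = Real.sqrt ε₁ := by field_simp
  rw [e1, e2] at h3
  exact h3

end Summit.QuantumFields.YangMills.Theorems.PoincareLipschitzKnitDoorRows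

end
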